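import Summits.HodgeConjecture.HodgeConjecture.Theorems.R90S1RamifiedShellOneFibre                   -- ★ (this seat) shell-one fibre = skew-sphere character integral (`|x|_w ≤ 1`) ∕ `0` (`|x|_w > 1`)
import Summits.HodgeConjecture.HodgeConjecture.Theorems.R90S1RamifiedSkewSphereCharacterIntegral     -- ★ (this seat) the skew-sphere character integral vanishes given a fixed unit `b₀` with `χ₁(b₀) ≠ 1`
import Summits.HodgeConjecture.HodgeConjecture.Theorems.R90S1RamifiedFixedUnitCharacterWitness       -- ★∕📤 (this seat) such a `b₀` exists at a tame ramified place (`hram`, `hdepth`)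
import HarnessLib

/-!
# R90 · S1 ∕ U4Keys leaf (U4f-χ₁-ram-one-d0B) — EVERY SHELL-ONE `y`-FIBRE OF `E ∘ z` VANISHES AT A TAME RAMIFIED BRANCH-B DEPTH-ZERO PLACE:
# `∫_{y ∈ R⁻ : |heisZ σ x y|_w = q_w} E(heisZ σ x y) dμ⁻ = 0` for every `x ∈ R` — the fibre form of the ramified odd-shell identity `∫_{Sh 1} F₀ = 0` (`h1` of ★ `R90S1KeysThmTwoDepthZeroBranchBRamified`)
# [Keys1984 §5, §7 Thm (2) (d); Rogawski1990 §1.10, §12.2 (2); NeukirchANT1999 Ch. I §9; PAPER-Z3-DepthZeroRamified §1 (R90-C10-p05 (g0), r01-screened)]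

Cell `hodgecm-mathlib`, SLAB R90-TF, section S1 «Ch. 12 local», crux H413 = `stmt-HodgeConjecture-24833` (lane `--supports … --as helper`), route HCCMUnconditional; prover seat
`hodgecm-mathlib-R90-C10-p05` (g0); socket of record S1#3′ = K2E3 leaf (U4f-χ₁-ram-one) ⊇ U4Keys :155 (depth 0, Branch B).  THEOREMS ONLY (no definition ∕ instance ∕ notation ∕
named fact ∕ `sorry`); ★-only imports.  FRAME (v1 spellings): `R := LocalRing L v`, `σ := conjLocal L c v`, `R⁻ = skewPart σ`, chart `z = heisZ σ x y`; `v` non-split (`hw`), `w ∣ v`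
RAMIFIED (`he`), `|2|_w = 1` (`h2w`, `[Invertible (2 : R)]`); the :155 letters `hdepth`, `hram`; `μ⁻ = μY` a regular additive Haar measure on `R⁻`; `E r := χ₁(r̂)` if `r ∈ Rˣ` else `0`.
THE POINT.  Composition of the three ★ bricks: ★ `heisZFibreOne_eq_skewSphereIntegral_ram` ∕ `heisZFibreOne_eq_zero_of_one_lt_valued_ram` (the fibre is the skew-sphere character
integral or `0`), ★ `exists_fixed_unit_apply_ne_one_ram` (a fixed unit `b₀` with `χ₁(b₀) ≠ 1`), ★ `skewSphereIntegral_dite_chi_eq_zero_of_fixed_unit` (orthogonality on the skew line).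
What then remains of the ramified odd-shell identity `h1` is only the (II)-type `x`-assembler `∫_{Sh 1} F₀ dμ_N = ∫_x (this fibre) dμR` (shared with the inert (II)-b3 and with `h0`) and the
Borel letter `hS1` of the skew sphere.
* **`heisZFibreOne_eq_zero_ram`**.
HONEST LABEL.  HC_CM is proved only modulo the 7 printed citations (2 remaining named inputs: hLiu418 = `stmt-HodgeConjecture-24832`, h413 = `stmt-HodgeConjecture-24833`) until rung 0
closes; count-neutral — this file does NOT pay the leaf; no printed citation is discharged.

## References
* [Keys1984] D. Keys, *Principal series representations of special unitary groups over local fields*, Compositio Math. 51 (1984), §5, §7 Theorem (2) (d) p. 126.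
* [Rogawski1990] J. D. Rogawski, *Automorphic Representations of Unitary Groups in Three Variables*, Ann. of Math. Stud. 123 (1990), §1.10 p. 9, §12.2 (2) p. 173.
* [NeukirchANT1999] J. Neukirch, *Algebraic Number Theory* (1999), Ch. I §9 Prop. (9.6).
-/

set_option autoImplicit false
-- the mandated namespace has the single-problem summit's repeated segment (`HodgeConjecture.HodgeConjecture`)
set_option linter.dupNamespace false

noncomputable section

open NumberField IsDedekindDomain MeasureTheory Measure Topology Set
open scoped NNReal ENNReal
open Literature.NumberTheory Literature.NumberTheory.Automorphic Literature.NumberTheory.Automorphic.UnitaryGroup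

namespace Summit.HodgeConjecture.HodgeConjecture.R90.S1

open Summit.HodgeConjecture.HodgeConjecture.Cruxes.H413

variable (L : Type) [Field L] [NumberField L] [IsCMField L] (v : HeightOneSpectrum (𝓞 ↥(maximalRealSubfield L)))
  (w : PlacesOver L v) (hw : IsCMField.complexConj L • w.1 = w.1)

set_option linter.overlappingInstances false in  -- `[μY.IsAddHaarMeasure] [μY.Regular]` are the binders of ★ `skewSphereIntegral_dite_chi_eq_zero_of_fixed_unit`
include hw in
open scoped Classical in
/-- **EVERY SHELL-ONE FIBRE VANISHES** at a tame ramified place in Branch B at depth zero: for every `x ∈ R`, `∫_{y ∈ R⁻ : |heisZ σ x y|_w = q_w} E(heisZ σ x y) dμ⁻ = 0` (`μ⁻` a regular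
additive Haar measure on `R⁻`; `hS1` the Borel-ness of the skew sphere `{|y|_w = q_w}`).  `|x|_w ≤ 1`: the fibre is the skew-sphere character integral (★ `heisZFibreOne_eq_skewSphereIntegral_ram`),
which vanishes (★ `skewSphereIntegral_dite_chi_eq_zero_of_fixed_unit`) on the fixed unit of ★ `exists_fixed_unit_apply_ne_one_ram`; `|x|_w > 1`: ★ `heisZFibreOne_eq_zero_of_one_lt_valued_ram`.
[cite: Keys1984, §5, §7 Theorem (2) (d) p. 126] [cite: Rogawski1990, §1.10 p. 9, §12.2 (2) p. 173] [cite: NeukirchANT1999, Ch. I §9 Prop. (9.6)] -/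
theorem heisZFibreOne_eq_zero_ram [Invertible (2 : LocalRing L v)] [MeasurableSpace (LocalRing L v)] [BorelSpace (LocalRing L v)]
    (he : v.asIdeal.ramificationIdx' w.1.asIdeal ≠ 1) (h2w : Valued.v (2 : w.1.adicCompletion L) = 1) (χ₁ : (LocalRing L v)ˣ →* ℂˣ)
    (hdepth : ∀ u : (LocalRing L v)ˣ, (∀ w' : PlacesOver L v, Valued.v (((u : LocalRing L v) w') - 1) < 1) → χ₁ u = 1)
    (hram : ¬ ∀ u ∈ (Submonoid.pi Set.univ (fun w' : PlacesOver L v => (w'.1.adicCompletionIntegers L).toSubring.toSubmonoid)).units, χ₁ u = 1)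
    (μY : Measure ↥(HeisRing.skewPart (conjLocal L (IsCMField.complexConj L) v))) [μY.IsAddHaarMeasure] [μY.Regular]
    (hS1 : MeasurableSet {y : ↥(HeisRing.skewPart (conjLocal L (IsCMField.complexConj L) v)) | Valued.v ((y : LocalRing L v) w) = WithZero.exp (1 : ℤ)})
    (x : LocalRing L v) :
    ∫ y in {y : ↥(HeisRing.skewPart (conjLocal L (IsCMField.complexConj L) v)) |
        Valued.v ((HeisRing.heisZ (conjLocal L (IsCMField.complexConj L) v) x (y : LocalRing L v)) w) = WithZero.exp (1 : ℤ)},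
        (fun r : LocalRing L v => if h : IsUnit r then ((χ₁ h.unit : ℂˣ) : ℂ) else 0)
          (HeisRing.heisZ (conjLocal L (IsCMField.complexConj L) v) x (y : LocalRing L v)) ∂μY = 0 := by
  rcases le_or_gt (Valued.v (x w)) 1 with hx | hx
  · obtain ⟨b₀, hb₀fix, hb₀v, hχ⟩ := exists_fixed_unit_apply_ne_one_ram L v w hw he h2w χ₁ hdepth hram
    rw [heisZFibreOne_eq_skewSphereIntegral_ram L v w hw μY he h2w χ₁ hdepth hS1 hx]
    exact skewSphereIntegral_dite_chi_eq_zero_of_fixed_unit L v w hw μY χ₁ b₀ hb₀fix hb₀v hχ (WithZero.exp (1 : ℤ))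
  · exact heisZFibreOne_eq_zero_of_one_lt_valued_ram L v w hw μY he h2w χ₁ hx

end Summit.HodgeConjecture.HodgeConjecture.R90.S1

end
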